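import Literature.Analysis.FluidPDE.PeriodicCylinderNeumannFrameWords
import Mathlib.Data.Finset.NatAntidiagonal
import HarnessLib

/-!
# Frame words of the Neumann problem on the period cell: all orders

Topic `Literature/Analysis/FluidPDE`. Support file (all results proved, no named facts) — the
general-order version of `PeriodicCylinderNeumannFrameWords` (there: words of length `≤ 4`, the order
needed for Ferrari's `H³` pressure estimate). Every sorted frame word `P^a J^j E^e q`
(`P = x_h·∇ = r∂_r`, `J = ∂_θ`, `E = ∂_z`, derivatives within the closed cylinder) of a function `q`
smooth on the closed cylinder is controlled in `L²(cell)` by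

* the gradients of its tangential words, `Σ_{j+e ≤ n} ‖∇ J^j E^e q‖` (`tanSize`), and
* the frame words of its Laplacian, `Σ_{l+j+e ≤ n−1} ‖P^l J^j E^e Δ_K q‖` (`frameSize`),

for all words of length `≤ n + 1` (`exists_cellL2_pje_le_sizes`): the normal derivatives are recovered
from the equation by `P P = r²(Δ_K − E E) − J J` (`cylDeriv_P_P_eq`), and powers of `P` pass the factor
`r²` by `P(r² h) = 2r² h + r² P h`, so that `P^i (r² h) = r² Σ_l c_{i,l} P^l h` with universal
coefficients (`pCoeff`, `cylWord_replicate_P_sqRadius_smul`); induction on the number of radial letters.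
For the smooth Neumann problem — `q`, `G` smooth on the closed cylinder, `L`-periodic, `x_h·∇q = G` on
the wall — the tangential estimate of every order (`cellL2_cylGrad_tanWord_le`,
`PeriodicCylinderNeumannTangential`) bounds `tanSize` by the frame words of `Δ_K q` and of `G` one
order lower plus `‖∇q‖` (`tanSize_le_of_neumann`), whence the main estimate
`exists_cellL2_pje_le_neumann`: **all frame words of `q` of length `≤ n+1` by the frame words of
`Δ_K q` of length `≤ n−1`, the gradients and values of the tangential words of `G` of length `≤ n−1`,
and `‖∇q‖`** — the input of the general-order `H^{k}` estimate of the Neumann/Helmholtz projector on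
the periodic cylinder (T. Kato, C. Y. Lai, J. Funct. Anal. 56 (1984) §4 (i): "P maps H^s into itself";
the analytic input of `Literature.Analysis.FluidPDE.KatoLai1984_periodicCylinderUniformExistence`).
All statements are folklore calculus given the cited tangential estimate.

Mathlib/tree search: everything from `PeriodicCylinderNeumannFrameWords` / `…Tangential` /
`…WithinCalculus` (`cylDeriv_P_sqRadius_smul`, `cylWord_tanWord_P_P_eq`, `cellL2_cylDeriv_P_le`,
`cellL2_cylDeriv_tanField_le`, `cylDeriv_finset_sum`, `cylDeriv_const_smul`); no general-order
statement existed (`lean search 'pje|frameWord'`).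

## References

* T. Kato, C. Y. Lai, J. Funct. Anal. 56 (1984) 15–28, §4 (i). [KatoLai1984]
* A. B. Ferrari, Comm. Math. Phys. 155 (1993), Lemma 2 pp. 280–281. [Ferrari1993]
-/

noncomputable section

open MeasureTheory Set Function Filter Topology TopologicalSpace WithLp Metric
open scoped ContDiff NNReal ENNReal InnerProductSpace RealInnerProductSpace

namespace Literature.Analysis.FluidPDE

open Literature.Analysis.FunctionSpaces

/-- Local notation for physical space `ℝ³ = EuclideanSpace ℝ (Fin 3)`. -/
local notation "ℝ³" => EuclideanSpace ℝ (Fin 3)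

/-- Local notation for the closed unit cylinder `{r ≤ 1}`. -/
local notation "𝕂" => closure (SetLike.coe unitCylinder : Set (EuclideanSpace ℝ (Fin 3)))

/-- Local notation for the radial field `P = x_h`. -/
local notation "Pf" => (fun y : EuclideanSpace ℝ (Fin 3) => horizontalProj y)

/-- Local notation for the axial field `E = e₂`. -/
local notation "Ef" => (fun _ : EuclideanSpace ℝ (Fin 3) => cylBasis 2)

/-- Local notation for the sorted frame word `P^a J^j E^e`. -/
local notation "pje[" a "," j "," e "]" =>
  (List.replicate a Pf ++ List.replicate j rotGen ++ List.replicate e Ef)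

variable {F : Type*} [NormedAddCommGroup F] [NormedSpace ℝ F]

/-! ### Powers of `P` through the factor `r²` -/

/-- The universal coefficients `c_{i,l}` with `P^i (r² h) = r² Σ_l c_{i,l} P^l h`
(`c_{0,l} = δ_{l0}`, `c_{i+1,l} = 2c_{i,l} + c_{i,l−1}`; in closed form `(i choose l) 2^{i−l}`, not
needed). [folklore] -/
def pCoeff : ℕ → ℕ → ℝ
  | 0, l => if l = 0 then 1 else 0
  | i + 1, l => 2 * pCoeff i l + (if l = 0 then 0 else pCoeff i (l - 1))

/-- `c_{i,l} = 0` for `l > i`. [folklore] -/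
theorem pCoeff_eq_zero_of_lt : ∀ {i l : ℕ}, i < l → pCoeff i l = 0
  | 0, l, h => by simp [pCoeff, Nat.ne_of_gt h]
  | i + 1, l, h => by
    have h1 : pCoeff i l = 0 := pCoeff_eq_zero_of_lt (by omega)
    have h2 : pCoeff i (l - 1) = 0 := pCoeff_eq_zero_of_lt (by omega)
    simp [pCoeff, h1, h2]

/-- **`P^i (r² h) = r² Σ_{l ≤ i} c_{i,l} P^l h`** on the closed cylinder. [folklore] -/
theorem cylWord_replicate_P_sqRadius_smul (i : ℕ) {h : ℝ³ → F} (hh : ContDiffOn ℝ ∞ h 𝕂) :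
    EqOn (cylWord (List.replicate i Pf) (fun y : ℝ³ => (y 0 ^ 2 + y 1 ^ 2) • h y))
      (fun x => (x 0 ^ 2 + x 1 ^ 2) • ∑ l ∈ Finset.range (i + 1), pCoeff i l • cylWord (List.replicate l Pf) h x) 𝕂 := by
  have hPl : ∀ l, ContDiffOn ℝ ∞ (cylWord (List.replicate l Pf) h) 𝕂 := fun l =>
    contDiffOn_cylWord (fun V hV => by rw [List.eq_of_mem_replicate hV]; exact contDiff_horizontalProj) hh
  induction i with
  | zero =>
    intro x hx
    simp [pCoeff]
  | succ i ih =>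
    intro x hx
    set S : ℝ³ → F := fun x => ∑ l ∈ Finset.range (i + 1), pCoeff i l • cylWord (List.replicate l Pf) h x with hS
    have hSs : ContDiffOn ℝ ∞ S 𝕂 := ContDiffOn.sum fun l _ => (hPl l).const_smul _
    rw [List.replicate_succ, cylWord_cons, cylDeriv_congr ih hx]
    show cylDeriv Pf (fun y => (y 0 ^ 2 + y 1 ^ 2) • S y) x = _
    rw [cylDeriv_P_sqRadius_smul hSs hx]
    -- `P S = Σ c_{i,l} P^{l+1} h`
    have hPS : cylDeriv Pf S x = ∑ l ∈ Finset.range (i + 1), pCoeff i l • cylWord (List.replicate (l + 1) Pf) h x := by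
      rw [hS, cylDeriv_finset_sum _ (fun l _ => (hPl l).const_smul _) hx]
      refine Finset.sum_congr rfl fun l _ => ?_
      rw [cylDeriv_const_smul _ (hPl l) hx, List.replicate_succ, cylWord_cons]
    have key : (2 : ℝ) • S x + ∑ l ∈ Finset.range (i + 1), pCoeff i l • cylWord (List.replicate (l + 1) Pf) h x =
        ∑ l ∈ Finset.range (i + 1 + 1), pCoeff (i + 1) l • cylWord (List.replicate l Pf) h x := by
      have e1 : ∀ l, pCoeff (i + 1) l • cylWord (List.replicate l Pf) h x =
          (2 * pCoeff i l) • cylWord (List.replicate l Pf) h x +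
            (if l = 0 then 0 else pCoeff i (l - 1)) • cylWord (List.replicate l Pf) h x := fun l => by
        rw [← add_smul]; rfl
      simp only [e1, Finset.sum_add_distrib]
      congr 1
      · rw [Finset.sum_range_succ, pCoeff_eq_zero_of_lt (Nat.lt_succ_self i), mul_zero, zero_smul, add_zero, hS,
          Finset.smul_sum]
        exact Finset.sum_congr rfl fun l _ => smul_smul _ _ _
      · conv_rhs => rw [Finset.sum_range_succ']
        have e0 : (if (0 : ℕ) = 0 then (0 : ℝ) else pCoeff i (0 - 1)) = 0 := if_pos rfl
        rw [e0, zero_smul, add_zero]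
        refine Finset.sum_congr rfl fun l _ => ?_
        rw [if_neg (Nat.add_one_ne_zero l), Nat.add_sub_cancel]
    rw [hPS, mul_comm (2 : ℝ), mul_smul, ← smul_add, key]

/-! ### The sizes -/

section Sizes

variable (L : ℝ)

/-- **The tangential size** `Σ_{j+e ≤ m} ‖∇ J^j E^e q‖_{L²(cell)}` (indexed by the total length
`k ≤ m` and the antidiagonal `j + e = k`). [folklore] -/
def tanSize (m : ℕ) (q : ℝ³ → ℝ) : ℝ :=
  ∑ k ∈ Finset.range (m + 1), ∑ p ∈ Finset.HasAntidiagonal.antidiagonal k, cellL2 L (cylGrad (cylWord pje[0, p.1, p.2] q))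

/-- **The frame size** `Σ_{l+j+e ≤ m} ‖P^l J^j E^e f‖_{L²(cell)}` (all sorted frame words of length
`≤ m`, the empty word included). [folklore] -/
def frameSize (m : ℕ) (f : ℝ³ → F) : ℝ :=
  ∑ k ∈ Finset.range (m + 1), ∑ p ∈ Finset.HasAntidiagonal.antidiagonal k, ∑ p' ∈ Finset.HasAntidiagonal.antidiagonal p.2,
    cellL2 L (cylWord pje[p.1, p'.1, p'.2] f)

variable {L}

/-- The tangential size is nonnegative. [folklore] -/
theorem tanSize_nonneg (m : ℕ) (q : ℝ³ → ℝ) : 0 ≤ tanSize L m q := by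
  rw [tanSize]
  exact Finset.sum_nonneg fun _ _ => Finset.sum_nonneg fun _ _ => cellL2_nonneg _ _

/-- The frame size is nonnegative. [folklore] -/
theorem frameSize_nonneg (m : ℕ) (f : ℝ³ → F) : 0 ≤ frameSize L m f := by
  rw [frameSize]
  exact Finset.sum_nonneg fun _ _ => Finset.sum_nonneg fun _ _ => Finset.sum_nonneg fun _ _ => cellL2_nonneg _ _

/-- A single term of the tangential size. [folklore] -/
theorem cellL2_cylGrad_le_tanSize {m j e : ℕ} (h : j + e ≤ m) (q : ℝ³ → ℝ) :
    cellL2 L (cylGrad (cylWord pje[0, j, e] q)) ≤ tanSize L m q := by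
  rw [tanSize]
  have h0 : ∀ k ∈ Finset.range (m + 1),
      0 ≤ ∑ p ∈ Finset.HasAntidiagonal.antidiagonal k, cellL2 L (cylGrad (cylWord pje[0, p.1, p.2] q)) :=
    fun _ _ => Finset.sum_nonneg fun _ _ => cellL2_nonneg _ _
  refine le_trans ?_ (Finset.single_le_sum h0 (a := j + e) (Finset.mem_range.2 (by omega)))
  exact Finset.single_le_sum (f := fun p : ℕ × ℕ => cellL2 L (cylGrad (cylWord pje[0, p.1, p.2] q)))
    (fun _ _ => cellL2_nonneg _ _) (a := (j, e)) (Finset.HasAntidiagonal.mem_antidiagonal.2 rfl)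

/-- A single term of the frame size. [folklore] -/
theorem cellL2_le_frameSize {m l j e : ℕ} (h : l + j + e ≤ m) (f : ℝ³ → F) :
    cellL2 L (cylWord pje[l, j, e] f) ≤ frameSize L m f := by
  rw [frameSize]
  have h0 : ∀ k ∈ Finset.range (m + 1), 0 ≤ ∑ p ∈ Finset.HasAntidiagonal.antidiagonal k, ∑ p' ∈ Finset.HasAntidiagonal.antidiagonal p.2,
      cellL2 L (cylWord pje[p.1, p'.1, p'.2] f) :=
    fun _ _ => Finset.sum_nonneg fun _ _ => Finset.sum_nonneg fun _ _ => cellL2_nonneg _ _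
  refine le_trans ?_ (Finset.single_le_sum h0 (a := l + (j + e)) (Finset.mem_range.2 (by omega)))
  have h1 : ∀ p ∈ Finset.HasAntidiagonal.antidiagonal (l + (j + e)), 0 ≤ ∑ p' ∈ Finset.HasAntidiagonal.antidiagonal p.2,
      cellL2 L (cylWord pje[p.1, p'.1, p'.2] f) :=
    fun _ _ => Finset.sum_nonneg fun _ _ => cellL2_nonneg _ _
  refine le_trans ?_ (Finset.single_le_sum h1 (a := (l, j + e)) (Finset.HasAntidiagonal.mem_antidiagonal.2 rfl))
  exact Finset.single_le_sum (f := fun p' : ℕ × ℕ => cellL2 L (cylWord pje[l, p'.1, p'.2] f))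
    (fun _ _ => cellL2_nonneg _ _) (a := (j, e)) (Finset.HasAntidiagonal.mem_antidiagonal.2 rfl)

/-- The frame size is monotone in the order. [folklore] -/
theorem frameSize_mono {m m' : ℕ} (h : m ≤ m') (f : ℝ³ → F) : frameSize L m f ≤ frameSize L m' f := by
  rw [frameSize, frameSize]
  exact Finset.sum_le_sum_of_subset_of_nonneg (Finset.range_mono (by omega))
    fun _ _ _ => Finset.sum_nonneg fun _ _ => Finset.sum_nonneg fun _ _ => cellL2_nonneg _ _

/-- The tangential size is monotone in the order. [folklore] -/
theorem tanSize_mono {m m' : ℕ} (h : m ≤ m') (q : ℝ³ → ℝ) : tanSize L m q ≤ tanSize L m' q := by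
  rw [tanSize, tanSize]
  exact Finset.sum_le_sum_of_subset_of_nonneg (Finset.range_mono (by omega))
    fun _ _ _ => Finset.sum_nonneg fun _ _ => cellL2_nonneg _ _

end Sizes

/-! ### All frame words by the sizes -/

section Main

variable {L : ℝ} {q : ℝ³ → ℝ} (hq : ContDiffOn ℝ ∞ q 𝕂)
include hq

/-- `P^a J^j E^e q = P^a (Z^{τ(j,e)} q)`, and the inner word is smooth. [folklore] -/
theorem contDiffOn_cylWord_pje' (a j e : ℕ) : ContDiffOn ℝ ∞ (cylWord pje[a, j, e] q) 𝕂 :=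
  contDiffOn_cylWord_pje a j e hq

/-- **No radial letter**: a nonempty tangential word is bounded by the gradient of a shorter one,
`‖J^j E^e q‖ ≤ tanSize m` for `1 ≤ j + e ≤ m + 1`. [folklore] -/
theorem cellL2_pje_zero_le_tanSize {m j e : ℕ} (h1 : 1 ≤ j + e) (hm : j + e ≤ m + 1) :
    cellL2 L (cylWord pje[0, j, e] q) ≤ tanSize L m q := by
  rcases j with _ | j'
  · obtain ⟨e', rfl⟩ : ∃ e', e = e' + 1 := ⟨e - 1, by omega⟩
    have hw : cylWord pje[0, 0, e' + 1] q = cylDeriv Ef (cylWord pje[0, 0, e'] q) := by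
      simp only [List.replicate_zero, List.nil_append, List.replicate_succ, cylWord_cons]
    rw [hw]
    exact (cellL2_cylDeriv_tanField_le L false (contDiffOn_cylWord_pje 0 0 e' hq)).trans
      (cellL2_cylGrad_le_tanSize (by omega) q)
  · have hw : cylWord pje[0, j' + 1, e] q = cylDeriv rotGen (cylWord pje[0, j', e] q) := by
      simp only [List.replicate_zero, List.nil_append, List.replicate_succ, List.cons_append, cylWord_cons]
    rw [hw]
    exact (cellL2_cylDeriv_tanField_le L true (contDiffOn_cylWord_pje 0 j' e hq)).trans
      (cellL2_cylGrad_le_tanSize (by omega) q)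

/-- **One radial letter**: `‖P J^j E^e q‖ ≤ tanSize m` for `j + e ≤ m`. [folklore] -/
theorem cellL2_pje_one_le_tanSize {m j e : ℕ} (hm : j + e ≤ m) :
    cellL2 L (cylWord pje[1, j, e] q) ≤ tanSize L m q := by
  have hw : cylWord pje[1, j, e] q = cylDeriv Pf (cylWord pje[0, j, e] q) := by
    rw [cylWord_pje_eq, cylWord_pje_eq, List.replicate_zero, cylWord_nil]; rfl
  rw [hw]
  exact (cellL2_cylDeriv_P_le L (contDiffOn_cylWord_pje 0 j e hq)).trans (cellL2_cylGrad_le_tanSize hm q)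

omit [NormedSpace ℝ F] hq in
/-- `cellL2` of a finite sum. [folklore] -/
theorem cellL2_finset_sum_le {ι' : Type*} (s : Finset ι') {f : ι' → ℝ³ → F} (hf : ∀ i ∈ s, ContinuousOn (f i) 𝕂) :
    cellL2 L (fun x => ∑ i ∈ s, f i x) ≤ ∑ i ∈ s, cellL2 L (f i) := by
  classical
  induction s using Finset.induction_on with
  | empty => simp [cellL2]
  | insert a s ha ih =>
    have hfa : ContinuousOn (f a) 𝕂 := hf a (Finset.mem_insert_self a s)
    have hfs : ∀ i ∈ s, ContinuousOn (f i) 𝕂 := fun i hi => hf i (Finset.mem_insert_of_mem hi)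
    simp only [Finset.sum_insert ha]
    exact (cellL2_add_le L hfa (continuousOn_finsetSum s hfs)).trans (add_le_add le_rfl (ih hfs))

omit hq in
/-- `P^a (f − g) = P^a f − P^a g` on the closed cylinder. [folklore] -/
theorem cylWord_replicate_P_sub (a : ℕ) {f g : ℝ³ → F} (hf : ContDiffOn ℝ ∞ f 𝕂) (hg : ContDiffOn ℝ ∞ g 𝕂) :
    EqOn (cylWord (List.replicate a Pf) (fun x => f x - g x))
      (fun x => cylWord (List.replicate a Pf) f x - cylWord (List.replicate a Pf) g x) 𝕂 := by
  have hP : ∀ a, ∀ V ∈ List.replicate a Pf, ContDiff ℝ ∞ V := fun a V hV => by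
    rw [List.eq_of_mem_replicate hV]; exact contDiff_horizontalProj
  induction a with
  | zero => intro x _; rfl
  | succ a ih =>
    intro x hx
    simp only [List.replicate_succ, cylWord_cons]
    rw [cylDeriv_congr ih hx]
    exact cylDeriv_sub (contDiffOn_cylWord (hP a) hf) (contDiffOn_cylWord (hP a) hg) hx

/-- **Two more radial letters from the equation**: for every `a` there is `K` (universal) with
`‖P^{a+2} J^j E^e q‖ ≤ K (Σ_{l ≤ a} (‖P^l J^j E^e Δ_K q‖ + ‖P^l J^j E^{e+2} q‖) + ‖P^a J^{j+2} E^e q‖)`.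
[folklore] -/
theorem cellL2_pje_add_two_le (a j e : ℕ) :
    cellL2 L (cylWord pje[a + 2, j, e] q) ≤
      (∑ l ∈ Finset.range (a + 1), |pCoeff a l| *
        (cellL2 L (cylWord pje[l, j, e] (cylLap q)) + cellL2 L (cylWord pje[l, j, e + 2] q))) +
      cellL2 L (cylWord pje[a, j + 2, e] q) := by
  set τ : List Bool := List.replicate j true ++ List.replicate e false with hτ
  have hLq : ContDiffOn ℝ ∞ (cylLap q) 𝕂 := contDiffOn_cylLap hq
  have hEE : ContDiffOn ℝ ∞ (cylDeriv Ef (cylDeriv Ef q)) 𝕂 :=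
    contDiffOn_cylDeriv contDiff_const (contDiffOn_cylDeriv contDiff_const hq)
  have hJJ : ContDiffOn ℝ ∞ (cylDeriv rotGen (cylDeriv rotGen q)) 𝕂 :=
    contDiffOn_cylDeriv contDiff_rotGen (contDiffOn_cylDeriv contDiff_rotGen hq)
  -- the three pieces inside the tangential word
  set A : ℝ³ → ℝ := fun x => cylWord (tanWord τ) (cylLap q) x - cylWord (tanWord τ) (cylDeriv Ef (cylDeriv Ef q)) x with hA
  set B : ℝ³ → ℝ := cylWord (tanWord τ) (cylDeriv rotGen (cylDeriv rotGen q)) with hB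
  have hAs : ContDiffOn ℝ ∞ A 𝕂 := (contDiffOn_cylWord_tanWord τ hLq).sub (contDiffOn_cylWord_tanWord τ hEE)
  have hBs : ContDiffOn ℝ ∞ B 𝕂 := contDiffOn_cylWord_tanWord τ hJJ
  have hPword : ∀ V ∈ List.replicate a Pf, ContDiff ℝ ∞ V := fun V hV => by
    rw [List.eq_of_mem_replicate hV]; exact contDiff_horizontalProj
  -- `P^{a+2} Z^τ q = P^a (Z^τ (P P q)) = P^a (r² A − B)`
  have h1 : EqOn (cylWord pje[a + 2, j, e] q)
      (cylWord (List.replicate a Pf) (fun x => (x 0 ^ 2 + x 1 ^ 2) • A x - B x)) 𝕂 := by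
    have e1 : cylWord pje[a + 2, j, e] q = cylWord (List.replicate a Pf) (cylWord pje[2, j, e] q) := by
      rw [cylWord_pje_eq, show a + 2 = a + 2 from rfl, List.replicate_add, cylWord_append, cylWord_pje_eq]
    rw [e1]
    refine cylWord_congr _ fun x hx => ?_
    rw [cylWord_pje_eq]
    have h := cylWord_tanWord_cylWord_pje τ 2 0 0 hq hx
    simp only [List.replicate_zero, List.append_nil] at h
    rw [← hτ, show cylWord (List.replicate 2 Pf) (cylWord (tanWord τ) q) x =
      cylWord (tanWord τ) (cylWord (List.replicate 2 Pf) q) x from h.symm]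
    exact cylWord_tanWord_P_P_eq hq τ hx
  -- `P^a (r² A − B) = r² Σ c_l P^l A − P^a B`
  have hρA : ContDiffOn ℝ ∞ (fun y : ℝ³ => (y 0 ^ 2 + y 1 ^ 2) • A y) 𝕂 :=
    (((contDiff_cylCoordFun 0).pow 2).add ((contDiff_cylCoordFun 1).pow 2)).contDiffOn.smul hAs
  have hsub := cylWord_replicate_P_sub a hρA hBs
  have h2 := cylWord_replicate_P_sqRadius_smul a hAs
  -- the combination `Σ c_l P^l A`
  set S : ℝ³ → ℝ := fun x => ∑ l ∈ Finset.range (a + 1), pCoeff a l • cylWord (List.replicate l Pf) A x with hS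
  have hPlA : ∀ l, ContDiffOn ℝ ∞ (cylWord (List.replicate l Pf) A) 𝕂 := fun l =>
    contDiffOn_cylWord (fun V hV => by rw [List.eq_of_mem_replicate hV]; exact contDiff_horizontalProj) hAs
  have hSc : ContinuousOn S 𝕂 := continuousOn_finsetSum _ fun l _ => ((hPlA l).const_smul _).continuousOn
  have hPaB : ContDiffOn ℝ ∞ (cylWord (List.replicate a Pf) B) 𝕂 := contDiffOn_cylWord hPword hBs
  have htot : EqOn (cylWord pje[a + 2, j, e] q) (fun x => (x 0 ^ 2 + x 1 ^ 2) • S x - cylWord (List.replicate a Pf) B x) 𝕂 :=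
    fun x hx => by
      rw [h1 hx]
      have e1 := hsub hx
      have e2 := h2 hx
      simp only [] at e1 e2 ⊢
      rw [e1, e2]
  rw [cellL2_congr_K htot]
  -- `P^l A = P^l Z^τ Δq − P^l J^j E^{e+2} q` and `P^a B = P^a J^{j+2} E^e q`
  have hPlA_eq : ∀ l, EqOn (cylWord (List.replicate l Pf) A)
      (fun x => cylWord pje[l, j, e] (cylLap q) x - cylWord pje[l, j, e + 2] q x) 𝕂 := by
    intro l
    have e2 : cylWord pje[l, j, e + 2] q = cylWord (List.replicate l Pf) (cylWord (tanWord τ) (cylDeriv Ef (cylDeriv Ef q))) := by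
      rw [hτ, cylWord_tanWord_E_E_eq j e, cylWord_pje_eq, cylWord_pje_eq, List.replicate_zero, cylWord_nil]
    have e1 : cylWord pje[l, j, e] (cylLap q) = cylWord (List.replicate l Pf) (cylWord (tanWord τ) (cylLap q)) := by
      rw [cylWord_pje_eq]
    rw [e1, e2]
    exact cylWord_replicate_P_sub l (contDiffOn_cylWord_tanWord τ hLq) (contDiffOn_cylWord_tanWord τ hEE)
  have hPaB_eq : EqOn (cylWord (List.replicate a Pf) B) (cylWord pje[a, j + 2, e] q) 𝕂 := by
    intro x hx
    rw [hB, hτ, cylWord_pje_eq]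
    exact cylWord_congr _ (cylWord_tanWord_J_J_eqOn hq j e) hx |>.trans (by rw [cylWord_pje_eq, List.replicate_zero, cylWord_nil])
  -- estimate
  have hterm : ∀ l ∈ Finset.range (a + 1), ContinuousOn (fun x => pCoeff a l • cylWord (List.replicate l Pf) A x) 𝕂 :=
    fun l _ => ((hPlA l).const_smul _).continuousOn
  calc cellL2 L (fun x => (x 0 ^ 2 + x 1 ^ 2) • S x - cylWord (List.replicate a Pf) B x)
      ≤ cellL2 L S + cellL2 L (cylWord (List.replicate a Pf) B) := cellL2_sqRadius_smul_sub_le hSc hPaB.continuousOn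
    _ ≤ (∑ l ∈ Finset.range (a + 1), cellL2 L (fun x => pCoeff a l • cylWord (List.replicate l Pf) A x)) +
        cellL2 L (cylWord pje[a, j + 2, e] q) := add_le_add (cellL2_finset_sum_le _ hterm) (by rw [cellL2_congr_K hPaB_eq])
    _ ≤ (∑ l ∈ Finset.range (a + 1), |pCoeff a l| *
        (cellL2 L (cylWord pje[l, j, e] (cylLap q)) + cellL2 L (cylWord pje[l, j, e + 2] q))) +
        cellL2 L (cylWord pje[a, j + 2, e] q) := by
        refine add_le_add (Finset.sum_le_sum fun l _ => ?_) le_rfl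
        refine (cellL2_smul_le _ _).trans (mul_le_mul_of_nonneg_left ?_ (abs_nonneg _))
        rw [cellL2_congr_K (hPlA_eq l)]
        exact cellL2_sub_le (contDiffOn_cylWord_pje l j e hLq).continuousOn (contDiffOn_cylWord_pje l j (e + 2) hq).continuousOn

end Main

/-- **All frame words by the sizes**: for every `n` there is `C` such that for every `q` smooth on
the closed cylinder and every sorted frame word of length `1 ≤ a + j + e ≤ n + 1`,
`‖P^a J^j E^e q‖_{L²(cell)} ≤ C (tanSize n q + frameSize (n − 1) (Δ_K q))`. [folklore] -/
theorem exists_cellL2_pje_le_sizes (L : ℝ) (n : ℕ) :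
    ∃ C : ℝ, 0 ≤ C ∧ ∀ (q : ℝ³ → ℝ), ContDiffOn ℝ ∞ q 𝕂 → ∀ a j e : ℕ, 1 ≤ a + j + e → a + j + e ≤ n + 1 →
      cellL2 L (cylWord pje[a, j, e] q) ≤ C * (tanSize L n q + frameSize L (n - 1) (cylLap q)) := by
  -- induction on the number of radial letters, for all lengths at once
  suffices h : ∀ amax : ℕ, ∃ C : ℝ, 0 ≤ C ∧ ∀ (q : ℝ³ → ℝ), ContDiffOn ℝ ∞ q 𝕂 →
      ∀ a j e : ℕ, a ≤ amax → 1 ≤ a + j + e → a + j + e ≤ n + 1 →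
        cellL2 L (cylWord pje[a, j, e] q) ≤ C * (tanSize L n q + frameSize L (n - 1) (cylLap q)) by
    obtain ⟨C, hC0, hC⟩ := h (n + 1)
    exact ⟨C, hC0, fun q hq a j e h1 hn => hC q hq a j e (by omega) h1 hn⟩
  intro amax
  induction amax with
  | zero =>
    -- no radial letter
    refine ⟨1, zero_le_one, fun q hq a j e ha h1 hn => ?_⟩
    obtain rfl : a = 0 := by omega
    have h0 := cellL2_pje_zero_le_tanSize (L := L) (m := n) (j := j) (e := e) hq (by omega) (by omega)
    have hf := frameSize_nonneg (L := L) (n - 1) (cylLap q)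
    linarith
  | succ amax ih =>
    obtain ⟨C₁, hC₁0, hC₁⟩ := ih
    rcases amax with _ | a
    · -- at most one radial letter
      refine ⟨max C₁ 1, le_max_of_le_left hC₁0, fun q hq a j e ha h1 hn => ?_⟩
      have hSz0 : 0 ≤ tanSize L n q + frameSize L (n - 1) (cylLap q) :=
        add_nonneg (tanSize_nonneg _ _) (frameSize_nonneg _ _)
      rcases a with _ | a
      · exact (hC₁ q hq 0 j e le_rfl h1 hn).trans (mul_le_mul_of_nonneg_right (le_max_left _ _) hSz0)
      · obtain rfl : a = 0 := by omega
        have h0 := cellL2_pje_one_le_tanSize (L := L) (m := n) (j := j) (e := e) hq (by omega)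
        have hf := frameSize_nonneg (L := L) (n - 1) (cylLap q)
        have hm : (1 : ℝ) ≤ max C₁ 1 := le_max_right _ _
        have ht := tanSize_nonneg (L := L) n q
        nlinarith
    · -- `a + 2` radial letters from `≤ a + 1`
      set K : ℝ := (∑ l ∈ Finset.range (a + 1), |pCoeff a l|) * (1 + C₁) + C₁ with hK
      have hK0 : 0 ≤ K := by positivity
      refine ⟨max C₁ K, le_max_of_le_left hC₁0, fun q hq a' j e ha h1 hn => ?_⟩
      set Sz : ℝ := tanSize L n q + frameSize L (n - 1) (cylLap q) with hSz
      have hSz0 : 0 ≤ Sz := add_nonneg (tanSize_nonneg _ _) (frameSize_nonneg _ _)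
      by_cases hsmall : a' ≤ a + 1
      · exact (hC₁ q hq a' j e hsmall h1 hn).trans (mul_le_mul_of_nonneg_right (le_max_left _ _) hSz0)
      · obtain rfl : a' = a + 2 := by omega
        have hmain := cellL2_pje_add_two_le (L := L) hq a j e
        have hdata : ∀ l ∈ Finset.range (a + 1), cellL2 L (cylWord pje[l, j, e] (cylLap q)) ≤ Sz := fun l hl => by
          have hl' := Finset.mem_range.1 hl
          exact (cellL2_le_frameSize (by omega) (cylLap q)).trans (le_add_of_nonneg_left (tanSize_nonneg _ _))
        have hrec1 : ∀ l ∈ Finset.range (a + 1), cellL2 L (cylWord pje[l, j, e + 2] q) ≤ C₁ * Sz := fun l hl => by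
          have hl' := Finset.mem_range.1 hl
          exact hC₁ q hq l j (e + 2) (by omega) (by omega) (by omega)
        have hrec2 : cellL2 L (cylWord pje[a, j + 2, e] q) ≤ C₁ * Sz :=
          hC₁ q hq a (j + 2) e (by omega) (by omega) (by omega)
        calc cellL2 L (cylWord pje[a + 2, j, e] q)
            ≤ (∑ l ∈ Finset.range (a + 1), |pCoeff a l| * (Sz + C₁ * Sz)) + C₁ * Sz := by
              refine hmain.trans (add_le_add (Finset.sum_le_sum fun l hl => ?_) hrec2)
              exact mul_le_mul_of_nonneg_left (add_le_add (hdata l hl) (hrec1 l hl)) (abs_nonneg _)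
          _ = K * Sz := by rw [hK, ← Finset.sum_mul]; ring
          _ ≤ max C₁ K * Sz := mul_le_mul_of_nonneg_right (le_max_right _ _) hSz0

/-! ### The Neumann problem: the tangential size by the data -/

/-- **The tangential size of a smooth periodic Neumann solution by the data**: for `q`, `G` smooth on
the closed cylinder, `L`-periodic, with `x_h·∇q = G` on the wall,
`tanSize (n+1) q ≤ N_n (‖∇q‖ + frameSize n (Δ_K q) + 2 tanSize n G + 2 frameSize n G)`,
`N_n = Σ_{k ≤ n+1} (k+1)` the number of terms (`cellL2_cylGrad_tanWord_le` for every nonempty sorted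
tangential word). [folklore] -/
theorem tanSize_le_of_neumann {L : ℝ} (hL : 0 < L) {q G : ℝ³ → ℝ}
    (hq : ContDiffOn ℝ ∞ q 𝕂) (hG : ContDiffOn ℝ ∞ G 𝕂) (hqp : IsAxiallyPeriodic L q)
    (hGp : IsAxiallyPeriodic L G)
    (hN : ∀ x ∈ frontier (unitCylinder : Set ℝ³), cylDeriv (fun y => horizontalProj y) q x = G x) (n : ℕ) :
    tanSize L (n + 1) q ≤ (∑ k ∈ Finset.range (n + 2), ((k : ℝ) + 1)) *
      (cellL2 L (cylGrad q) + frameSize L n (cylLap q) + 2 * tanSize L n G + 2 * frameSize L n G) := by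
  set D : ℝ := cellL2 L (cylGrad q) + frameSize L n (cylLap q) + 2 * tanSize L n G + 2 * frameSize L n G with hD
  have hg0 := cellL2_nonneg L (cylGrad q)
  have hD0 : 0 ≤ D := by
    have := frameSize_nonneg (L := L) n (cylLap q); have := tanSize_nonneg (L := L) n G
    have := frameSize_nonneg (L := L) n G; positivity
  -- every word of the size is bounded by `D`
  have hword : ∀ j e : ℕ, j + e ≤ n + 1 → cellL2 L (cylGrad (cylWord pje[0, j, e] q)) ≤ D := by
    intro j e hje
    by_cases h0 : j + e = 0
    · obtain ⟨rfl, rfl⟩ : j = 0 ∧ e = 0 := by omega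
      simp only [List.replicate_zero, List.append_nil, cylWord_nil]
      have := frameSize_nonneg (L := L) n (cylLap q); have := tanSize_nonneg (L := L) n G
      have := frameSize_nonneg (L := L) n G
      linarith
    -- write the word as `b :: β` with `β` sorted of length `j + e − 1`
    rcases j with _ | j'
    · obtain ⟨e', rfl⟩ : ∃ e', e = e' + 1 := ⟨e - 1, by omega⟩
      have hw : cylWord pje[0, 0, e' + 1] q = cylWord (tanWord (false :: (List.replicate 0 true ++ List.replicate e' false))) q := by
        rw [cylWord_pje_eq, List.replicate_zero, cylWord_nil]
        simp [tanWord, tanField, List.replicate_succ]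
      rw [hw]
      refine (cellL2_cylGrad_tanWord_le hL hq hG hqp hGp hN false _).trans ?_
      rw [tanWord_replicate]
      have t1 : cellL2 L (cylWord pje[0, 0, e'] (cylLap q)) ≤ frameSize L n (cylLap q) := cellL2_le_frameSize (by omega) _
      have t2 : cellL2 L (cylGrad (cylWord pje[0, 0, e'] G)) ≤ tanSize L n G := cellL2_cylGrad_le_tanSize (by omega) _
      have t3 : cellL2 L (cylWord pje[0, 0, e'] G) ≤ frameSize L n G := cellL2_le_frameSize (by omega) _
      simp only [List.replicate_zero, List.nil_append] at t1 t2 t3 ⊢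
      linarith
    · have hw : cylWord pje[0, j' + 1, e] q = cylWord (tanWord (true :: (List.replicate j' true ++ List.replicate e false))) q := by
        rw [cylWord_pje_eq, List.replicate_zero, cylWord_nil]
        simp [tanWord, tanField, List.replicate_succ]
      rw [hw]
      refine (cellL2_cylGrad_tanWord_le hL hq hG hqp hGp hN true _).trans ?_
      rw [tanWord_replicate]
      have t1 : cellL2 L (cylWord pje[0, j', e] (cylLap q)) ≤ frameSize L n (cylLap q) := cellL2_le_frameSize (by omega) _
      have t2 : cellL2 L (cylGrad (cylWord pje[0, j', e] G)) ≤ tanSize L n G := cellL2_cylGrad_le_tanSize (by omega) _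
      have t3 : cellL2 L (cylWord pje[0, j', e] G) ≤ frameSize L n G := cellL2_le_frameSize (by omega) _
      simp only [List.replicate_zero, List.nil_append] at t1 t2 t3 ⊢
      linarith
  -- sum
  rw [tanSize, Finset.sum_mul]
  refine Finset.sum_le_sum fun k hk => ?_
  have hk' := Finset.mem_range.1 hk
  calc ∑ p ∈ Finset.HasAntidiagonal.antidiagonal k, cellL2 L (cylGrad (cylWord pje[0, p.1, p.2] q))
      ≤ ∑ p ∈ Finset.HasAntidiagonal.antidiagonal k, D := Finset.sum_le_sum fun p hp => by
        have hp' := Finset.HasAntidiagonal.mem_antidiagonal.1 hp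
        exact hword p.1 p.2 (by omega)
    _ = ((k : ℝ) + 1) * D := by
        rw [Finset.sum_const, nsmul_eq_mul, Finset.Nat.card_antidiagonal]; push_cast; ring

/-- **All frame words of a smooth periodic Neumann solution by the data**: for `L > 0` and every `n`
there is `C` such that for all `q`, `G` smooth on the closed cylinder, `L`-periodic, with
`x_h·∇q = G` on the wall, and every sorted frame word with `1 ≤ a + j + e ≤ n + 2`,
`‖P^a J^j E^e q‖ ≤ C (‖∇q‖ + frameSize n (Δ_K q) + tanSize n G + frameSize n G)`. [folklore] -/
theorem exists_cellL2_pje_le_neumann {L : ℝ} (hL : 0 < L) (n : ℕ) :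
    ∃ C : ℝ, 0 ≤ C ∧ ∀ (q G : ℝ³ → ℝ), ContDiffOn ℝ ∞ q 𝕂 → ContDiffOn ℝ ∞ G 𝕂 → IsAxiallyPeriodic L q →
      IsAxiallyPeriodic L G →
      (∀ x ∈ frontier (unitCylinder : Set ℝ³), cylDeriv (fun y => horizontalProj y) q x = G x) →
      ∀ a j e : ℕ, 1 ≤ a + j + e → a + j + e ≤ n + 2 →
        cellL2 L (cylWord pje[a, j, e] q) ≤
          C * (cellL2 L (cylGrad q) + frameSize L n (cylLap q) + tanSize L n G + frameSize L n G) := by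
  obtain ⟨C₁, hC₁0, hC₁⟩ := exists_cellL2_pje_le_sizes L (n + 1)
  set N : ℝ := ∑ k ∈ Finset.range (n + 2), ((k : ℝ) + 1) with hN
  have hN0 : 0 ≤ N := Finset.sum_nonneg fun k _ => by positivity
  refine ⟨C₁ * (2 * N + 1), by positivity, fun q G hq hG hqp hGp hNeu a j e h1 hn => ?_⟩
  have htan := tanSize_le_of_neumann hL hq hG hqp hGp hNeu n
  have h := hC₁ q hq a j e h1 hn
  simp only [Nat.add_sub_cancel] at h
  refine h.trans ?_
  have hg0 := cellL2_nonneg L (cylGrad q)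
  have hf0 := frameSize_nonneg (L := L) n (cylLap q)
  have ht0 := tanSize_nonneg (L := L) n G
  have hF0 := frameSize_nonneg (L := L) n G
  rw [mul_assoc]
  refine mul_le_mul_of_nonneg_left ?_ hC₁0
  nlinarith [htan]

end Literature.Analysis.FluidPDE
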